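/-
Copyright (c) 2026 the pub-hodgecm-mathlib formalisation cell (harness21).  Prover seat hodgecm-mathlib-LH3-p01 (g7); dealer LH4-plan (g7) WORD #2 «LAYER B 3∕3 — F3»,
2026-09-02.  Count-neutral base layer of the dyadic (D-UNR) column (FINDINGS #6∕#6′ of the LH4 board); CENSUS-LAYERB-3of3 4277d501 row F3.
-/
import Literature.NumberTheory.Automorphic.UnitaryThreeTorusBlockElementsTrace        -- ★ F1 (LH3-p02): shape `Z_H(t) = {M(x,e,y)}`, norm-one ∕ unit coordinates, `|b| = |σb| = 1`
import Literature.NumberTheory.Automorphic.UnitaryThreeTorusDoubleCosetsHKDisjoint     -- ★ Prop. 6 (b) in Flicker's frame: `v_pow_lt_one` (CITED) — the statement twinned here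
import HarnessLib

/-!
# Flicker's Proposition 6 (b) in the TRACE frame: the double cosets `Z_H(t^{(b)}) · diag(ϖ^{−i},1,ϖ^{i}) · K_H` are pairwise distinct — every residue characteristic
(Flicker (1998), *Elementary proof of the fundamental lemma for a unitary group*, Prop. 6 p. 83; LAYER B 3∕3, file F3 of CENSUS-LAYERB-3of3)

Topic `NumberTheory/Automorphic`; namespace `Literature.NumberTheory.Automorphic.UnitaryGroup`.  THEOREMS ONLY (no `def`, no instance, no notation, no named fact,
no `sorry`); count-neutral; kernel lane `--supports stmt-HodgeConjecture-24833`.  Cell `pub/hodgecm-mathlib`, crux H413 = `stmt-HodgeConjecture-24833`; LH4 board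
(D-UNR) FINDING #6 «LAYER B» (the 2-free re-cut of Flicker's count engine): this is F3 of CENSUS-LAYERB-3of3 (LH3-p02 (g6), sha16 4277d501e16e5836) row
«`eq_of_centralizer_mul_diagRadial_mul_flickerKH_eq` RE-KEY», the trace-frame twin of ★ `UnitaryThreeTorusDoubleCosetsHKDisjoint` (Prop. 6 (b) for the
`(A, θ²C; C, A)`-shaped torus of Flicker's frame, whose datum `LocalConjDatum` carries `|2| = 1`).  Read with CENSUS-R1 52a4c879 (LH4-p03 (g8)) and FINDING #6′
(178∕178 numeric certificate).  Dealer's RULING (LH4-plan (g7) WORD #2) tokens: T2 datum `UnramifiedLocalConjDatum σ ϖ` + explicit `(h2 : (2 : K) ≠ 0)` (the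
CHARACTERISTIC token behind the block shape of `Z(diag(1,−1,1))`, ★ `exists_coe_eq_block_of_mem_centralizer` — free at every number-field completion; NOT `|2| = 1`);
T3 trace literal of ★ p851724 ∕ ★ p851796 ∕ ★ F1 with `(hb : b + σb = 1) (hbv : |b| ≤ 1) (hππ : ππ′ = 1) (hπε : π = ϖ^ε) (hx : x₁ ≠ x₃)` (no `hε : ε ≤ 1` here — ★ (b)
has none and the valuation reading does not need it); T4 objects `r i`, `c`, `flickerKH`, `H` unchanged; T5 conclusion BYTE-IDENTICAL to ★ (so ★ (F3a)
`FixedPointsTorusDoubleCosetCount` re-docks its binder `hB` by NAME at `G := ↥H`).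

MATHEMATICS (elementary, by valuations — as ★, with the trace corner).  If `τ r_i k = τ′ r_j k′` then `r_i = σ₀ · r_j · κ` with `σ₀ = τ⁻¹τ′ ∈ Z_H(t)` and
`κ = k′k⁻¹ ∈ K_H`.  By ★ F1 `exists_coe_eq_traceTorusBlock_of_mem_centralizer`, `σ₀ = M(x, e, y)` has corner `N = (xσb + yb, π(x − y); π′bσb(x − y), xb + yσb)` with
NORM-ONE (hence unit) `x, y` (★ F1 `map_mul_self_eq_one_of_coe_eq_traceTorusBlock`, `v_traceTorusBlock_coord_eq_one`) and `|b| = |σb| = 1` (★ F1 `v_eq_one_of_add_map_eq_one`,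
from `b + σb = 1`, `|b| ≤ 1` alone); `κ` has integral corner `(a β; γ δ)` with `|aδ − βγ| = 1` (★ γ0).  Reading the four corner entries of `r_i = σ₀ r_j κ`
(`Δ := aδ − βγ`): `a·ϖ^i = ϖ^j·(xb + yσb)·Δ`, `δ·ϖ^j = ϖ^i·(xσb + yb)·Δ`, `γ·ϖ^{i+j} = −π′bσb(x − y)·Δ`.  If `i ≠ j` the third gives `|x − y| ≤ |π|·|ϖ|^{i+j} < 1`, and then
`xσb + yb = x + (y − x)b` and `xb + yσb = y + (x − y)b` are UNITS — contradicting `|xσb + yb| = |δ|·|ϖ|^{j−i} < 1` (`i < j`) resp. `|xb + yσb| = |a|·|ϖ|^{i−j} < 1` (`j < i`).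
Hence `i = j`.  No `½`, no `|2| = 1`: the argument is the same at every residue characteristic (census §0.1).

HONEST LABEL: HC_CM is proved only modulo the printed citations (hLiu418 = `stmt-HodgeConjecture-24832`, h413 = `stmt-HodgeConjecture-24833`) until rung 0 closes; this is
structure theory, it pays no organ and opens no road ((D-UNR) stays PRINT by D74′); the COUNT heads `rankStrata_counts_of_congr_traceTorusElt{Pi,}` stay hypotheses of the
G-side until LAYER C lands (census §0.4).

## References
* [Flicker1998UnitaryFL] Y. Z. Flicker, *Elementary proof of the fundamental lemma for a unitary group*, Canad. J. Math. 50 (1998), Prop. 6 p. 83 (the double cosets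
  `T_H r_i K_H` are disjoint), §2 Prop. 3 pp. 78–79 (the torus literal).
* [Rogawski1990] J. D. Rogawski, *Automorphic Representations of Unitary Groups in Three Variables* (1990), §4.9 p. 55 (`H = U(2) × U(1)`, the radial decomposition).
* [Serre1979] J.-P. Serre, *Local Fields*, GTM 67, Ch. V §3 (norm-one elements of an unramified extension are units).
-/

set_option autoImplicit false

open Matrix
open scoped MatrixGroups WithZero

namespace Literature.NumberTheory.Automorphic.UnitaryGroup

open Literature.NumberTheory.Automorphic.HermitianLattice (unitaryInt UnramifiedLocalConjDatum)

variable {K : Type*} [Field K] [Valued K ℤᵐ⁰] {ϖ : K} (σ : K →+* K) {J : Matrix (Fin 3) (Fin 3) K}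
  (hJ : J = (StdForm.antidiagonal 3).over K) (hd : UnramifiedLocalConjDatum σ ϖ)

set_option maxHeartbeats 800000 in
-- explicit block computation + valuation case analysis (as ★ `eq_of_centralizer_mul_diagRadial_mul_flickerKH_eq`)
include hJ hd in
/-- **FLICKER'S PROPOSITION 6 (b) IN THE TRACE FRAME — THE DOUBLE COSETS `Z_H(t) · r_i · K_H` ARE PAIRWISE DISTINCT** (`r_i = diag(ϖ^{−i},1,ϖ^{i})`,
`t = M(x₁,x₂,x₃) = !![x₁σb + x₃b, 0, π(x₁ − x₃); 0, x₂, 0; π′bσb(x₁ − x₃), 0, x₁b + x₃σb]` a REGULAR trace torus block, `x₁ ≠ x₃`, `b + σb = 1`, `|b| ≤ 1`,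
`ππ′ = 1`, `π = ϖ^ε`; datum `UnramifiedLocalConjDatum σ ϖ` and the characteristic token `(2 : K) ≠ 0`): `τ r_i k = τ′ r_j k′ ⇒ i = j` — the binder `hB` of ★
`FixedPointsTorusDoubleCosetCount` VERBATIM at `G := ↥H`; twin of ★ `eq_of_centralizer_mul_diagRadial_mul_flickerKH_eq` with the torus literal in the trace frame and NO
`|2| = 1` (CENSUS-LAYERB-3of3 4277d501 row F3; CENSUS-R1 52a4c879; FINDING #6′). [cite: Flicker1998UnitaryFL, Prop. 6 p. 83] -/
theorem eq_of_centralizer_mul_diagRadial_mul_flickerKH_eq_trace (h2 : (2 : K) ≠ 0)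
    {c : ↥(unitaryGroupOfForm σ J)} (hc : ((c : GL (Fin 3) K) : Matrix (Fin 3) (Fin 3) K) = !![1, 0, 0; 0, -1, 0; 0, 0, 1])
    {b π π' : K} (hb : b + σ b = 1) (hbv : Valued.v b ≤ 1) (hππ : π * π' = 1) {ε : ℕ} (hπε : π = ϖ ^ ε)
    {t : ↥(unitaryGroupOfForm σ J)} (htH : t ∈ Subgroup.centralizer ({c} : Set ↥(unitaryGroupOfForm σ J))) {x₁ x₂ x₃ : K} (hx : x₁ ≠ x₃)
    (hte : ((t : GL (Fin 3) K) : Matrix (Fin 3) (Fin 3) K) =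
      !![x₁ * σ b + x₃ * b, 0, π * (x₁ - x₃); 0, x₂, 0; π' * (b * σ b * (x₁ - x₃)), 0, x₁ * b + x₃ * σ b])
    (r : ℕ → ↥(Subgroup.centralizer ({c} : Set ↥(unitaryGroupOfForm σ J))))
    (hr : ∀ i, (((r i : ↥(unitaryGroupOfForm σ J)) : GL (Fin 3) K) : Matrix (Fin 3) (Fin 3) K) = !![(ϖ ^ i)⁻¹, 0, 0; 0, 1, 0; 0, 0, ϖ ^ i]) :
    ∀ i j : ℕ, ∀ τ ∈ Subgroup.centralizer ({⟨t, htH⟩} : Set ↥(Subgroup.centralizer ({c} : Set ↥(unitaryGroupOfForm σ J)))),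
      ∀ τ' ∈ Subgroup.centralizer ({⟨t, htH⟩} : Set ↥(Subgroup.centralizer ({c} : Set ↥(unitaryGroupOfForm σ J)))),
      ∀ k ∈ (flickerKH σ J c).subgroupOf (Subgroup.centralizer ({c} : Set ↥(unitaryGroupOfForm σ J))),
      ∀ k' ∈ (flickerKH σ J c).subgroupOf (Subgroup.centralizer ({c} : Set ↥(unitaryGroupOfForm σ J))),
      τ * r i * k = τ' * r j * k' → i = j := by
  intro i j τ hτ τ' hτ' k hk k' hk' heq
  classical
  -- scalar facts
  have hϖ0 : ϖ ≠ 0 := fun h0 => by have := hd.vϖ; rw [h0, map_zero] at this; exact WithZero.zero_ne_coe this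
  have hvϖ := hd.vϖ
  have hσσ : ∀ z, σ (σ z) = z := hd.σσ
  have hσv : ∀ z, Valued.v (σ z) = Valued.v z := hd.vσ
  have hσπ : σ π = π := by rw [hπε, map_pow, hd.σϖ]
  have hπ'e : π' = π⁻¹ := eq_inv_of_mul_eq_one_right hππ
  have hσπ' : σ π' = π' := by rw [hπ'e, map_inv₀, hσπ]
  have hvπ : Valued.v π ≤ 1 := by
    rw [hπε, map_pow, hvϖ, ← WithZero.exp_nsmul, ← WithZero.exp_zero, WithZero.exp_le_exp]; simp
  -- `|b| = |σb| = |bσb| = 1` from `b + σb = 1`, `|b| ≤ 1` alone (★ F1)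
  obtain ⟨hvb, hvσb, hvbσb⟩ := v_eq_one_of_add_map_eq_one σ hσv hbv hb
  -- `σ₀ := τ⁻¹ τ′ ∈ Z_H(t)`, `κ := k′ k⁻¹ ∈ K_H`, `r_i = σ₀ r_j κ`
  set σ₀ : ↥(Subgroup.centralizer ({c} : Set ↥(unitaryGroupOfForm σ J))) := τ⁻¹ * τ' with hσ₀
  set κ : ↥(Subgroup.centralizer ({c} : Set ↥(unitaryGroupOfForm σ J))) := k' * k⁻¹ with hκ
  have hrel : r i = σ₀ * r j * κ := by
    rw [hσ₀, hκ]
    have : τ⁻¹ * (τ * r i * k) * k⁻¹ = τ⁻¹ * (τ' * r j * k') * k⁻¹ := by rw [heq]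
    simpa [mul_assoc, mul_inv_cancel_left, inv_mul_cancel_left] using this
  have hσ₀Z : σ₀ ∈ Subgroup.centralizer ({⟨t, htH⟩} : Set ↥(Subgroup.centralizer ({c} : Set ↥(unitaryGroupOfForm σ J)))) :=
    Subgroup.mul_mem _ (Subgroup.inv_mem _ hτ) hτ'
  have hκK : κ ∈ (flickerKH σ J c).subgroupOf (Subgroup.centralizer ({c} : Set ↥(unitaryGroupOfForm σ J))) :=
    Subgroup.mul_mem _ hk' (Subgroup.inv_mem _ hk)
  -- block shape of `κ ∈ H`
  obtain ⟨a, β, γ, δ, e₂, hκM⟩ := exists_coe_eq_block_of_mem_centralizer σ h2 hc (κ : ↥(Subgroup.centralizer _)).2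
  -- `σ₀ ∈ Z_H(t)` is a trace torus block `M(x, e, y)` with norm-one (unit) coordinates (★ F1)
  have hσ₀t : (σ₀ : ↥(unitaryGroupOfForm σ J)) ∈ Subgroup.centralizer ({t} : Set ↥(unitaryGroupOfForm σ J)) := by
    rw [Subgroup.mem_centralizer_singleton_iff]
    have := Subgroup.mem_centralizer_singleton_iff.1 hσ₀Z
    exact congrArg Subtype.val this
  obtain ⟨x, e, y, hσ₀M, -, -, -⟩ :=
    exists_coe_eq_traceTorusBlock_of_mem_centralizer σ h2 hc hb hππ hx hte (σ₀ : ↥(Subgroup.centralizer _)).2 hσ₀t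
  have hn1 := map_mul_self_eq_one_of_coe_eq_traceTorusBlock σ hJ hσσ hb hππ hσπ hσπ' hσ₀M
  obtain ⟨hvx, -, hvy⟩ := v_traceTorusBlock_coord_eq_one σ hσv hn1
  -- `κ ∈ K_H`: integral entries, and `|aδ − βγ| = 1`
  have hκK' := (Subgroup.mem_subgroupOf.1 hκK)
  rw [mem_flickerKH_iff] at hκK'
  have hκint := (mem_unitaryInt_iff_forall_v_apply_le_one σ hJ hσv _).1 hκK'.2
  have hva : Valued.v a ≤ 1 := by have := hκint 0 0; rwa [hκM] at this
  have hvδ : Valued.v δ ≤ 1 := by have := hκint 2 2; rwa [hκM] at this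
  have hvγ : Valued.v γ ≤ 1 := by have := hκint 2 0; rwa [hκM] at this
  have hκ3 : (((κ : ↥(Subgroup.centralizer _)) : ↥(unitaryGroupOfForm σ J)) : GL (Fin 3) K) ∈
      unitaryGroupOfForm σ ((StdForm.antidiagonal 3).over K) := by
    rw [← hJ]; exact ((κ : ↥(Subgroup.centralizer _)) : ↥(unitaryGroupOfForm σ J)).2
  have hvΔκ : Valued.v (a * δ - β * γ) = 1 := by
    obtain ⟨⟨R1, R2, R3, R4⟩, -⟩ := SplitDictionary.rel_of_coe_eq_block σ hκ3 hκM
    have hΔ := SplitDictionary.det_mul_map_det σ R1 R2 R3 R4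
    have h1 := congrArg Valued.v hΔ
    rw [map_mul, hσv, map_one] at h1
    exact Literature.NumberTheory.QuadraticForms.OMeara65.WithZeroMulInt.eq_one_of_mul_self h1
  -- the matrix equation `r_i = σ₀ r_j κ`, corner entries
  have hM : (((r i : ↥(unitaryGroupOfForm σ J)) : GL (Fin 3) K) : Matrix (Fin 3) (Fin 3) K) =
      (((σ₀ : ↥(Subgroup.centralizer _)) : ↥(unitaryGroupOfForm σ J)) : GL (Fin 3) K) *
        (((r j : ↥(unitaryGroupOfForm σ J)) : GL (Fin 3) K) : Matrix (Fin 3) (Fin 3) K) *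
        (((κ : ↥(Subgroup.centralizer _)) : ↥(unitaryGroupOfForm σ J)) : GL (Fin 3) K) := by
    rw [← Units.val_mul, ← Units.val_mul, ← Subgroup.coe_mul, ← Subgroup.coe_mul, ← Subgroup.coe_mul, ← Subgroup.coe_mul, ← hrel]
  rw [hr i, hσ₀M, hr j, hκM, block_mul_block, block_mul_block] at hM
  have hϖi0 : ϖ ^ i ≠ 0 := pow_ne_zero _ hϖ0
  have hϖj0 : ϖ ^ j ≠ 0 := pow_ne_zero _ hϖ0
  set wi : K := (ϖ ^ i)⁻¹ with hwi_def
  set wj : K := (ϖ ^ j)⁻¹ with hwj_def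
  have hwi : ϖ ^ i * wi = 1 := mul_inv_cancel₀ hϖi0
  have hwj : ϖ ^ j * wj = 1 := mul_inv_cancel₀ hϖj0
  have E00 : wi = (x * σ b + y * b) * wj * a + π * (x - y) * ϖ ^ j * γ := by
    have := congrArg (fun M : Matrix (Fin 3) (Fin 3) K => M 0 0) hM; simp at this; linear_combination this
  have E02 : (0 : K) = (x * σ b + y * b) * wj * β + π * (x - y) * ϖ ^ j * δ := by
    have := congrArg (fun M : Matrix (Fin 3) (Fin 3) K => M 0 2) hM; simp at this; linear_combination this
  have E20 : (0 : K) = π' * (b * σ b * (x - y)) * wj * a + (x * b + y * σ b) * ϖ ^ j * γ := by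
    have := congrArg (fun M : Matrix (Fin 3) (Fin 3) K => M 2 0) hM; simp at this; linear_combination this
  have E22 : ϖ ^ i = π' * (b * σ b * (x - y)) * wj * β + (x * b + y * σ b) * ϖ ^ j * δ := by
    have := congrArg (fun M : Matrix (Fin 3) (Fin 3) K => M 2 2) hM; simp at this; linear_combination this
  -- `a ϖ^i = ϖ^j (xb + yσb) Δ`, `δ ϖ^j = ϖ^i (xσb + yb) Δ`, `γ ϖ^{i+j} = −π′bσb(x − y) Δ`
  have hA : a * ϖ ^ i = ϖ ^ j * (x * b + y * σ b) * (a * δ - β * γ) := by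
    linear_combination a * E22 - β * E20
  have hE : δ * ϖ ^ j = ϖ ^ i * (x * σ b + y * b) * (a * δ - β * γ) := by
    linear_combination (ϖ ^ i * ϖ ^ j * δ) * E00 - (ϖ ^ i * ϖ ^ j * γ) * E02 + (-(δ * ϖ ^ j)) * hwi
      + (ϖ ^ i * (x * σ b + y * b) * (a * δ - β * γ)) * hwj
  have hCq : γ * ϖ ^ (i + j) = -(π' * (b * σ b * (x - y)) * (a * δ - β * γ)) := by
    rw [pow_add]
    linear_combination (ϖ ^ j * γ) * E22 - (ϖ ^ j * δ) * E20 + (-(π' * (b * σ b * (x - y)) * (a * δ - β * γ))) * hwj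
  -- valuations
  by_contra hij
  -- `|x − y| < 1` from the `(2,0)` entry: `|π′bσb(x − y)| = |γ|·|ϖ|^{i+j} ≤ |ϖ|^{i+j} < 1`, and `|π| ≤ 1`, `|bσb| = 1`
  have hxy : Valued.v (x - y) < 1 := by
    have h1 : Valued.v γ * Valued.v (ϖ ^ (i + j)) = Valued.v (π' * (b * σ b * (x - y))) := by
      have := congrArg Valued.v hCq
      rw [map_mul, Valuation.map_neg, map_mul, hvΔκ, mul_one] at this
      exact this
    have hij1 : 1 ≤ i + j := by omega
    have hn20 : Valued.v (π' * (b * σ b * (x - y))) < 1 :=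
      calc Valued.v (π' * (b * σ b * (x - y))) = Valued.v γ * Valued.v (ϖ ^ (i + j)) := h1.symm
        _ ≤ 1 * Valued.v (ϖ ^ (i + j)) := mul_le_mul_left hvγ _
        _ < 1 := by rw [one_mul]; exact v_pow_lt_one hvϖ hij1
    have hπn : π * (π' * (b * σ b * (x - y))) = b * σ b * (x - y) := by
      linear_combination (b * σ b * (x - y)) * hππ
    have h2' : Valued.v (b * σ b * (x - y)) < 1 := by
      rw [← hπn, map_mul]
      calc Valued.v π * Valued.v (π' * (b * σ b * (x - y))) ≤ 1 * Valued.v (π' * (b * σ b * (x - y))) := mul_le_mul_left hvπ _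
        _ < 1 := by rw [one_mul]; exact hn20
    rwa [map_mul, hvbσb, one_mul] at h2'
  rcases Nat.lt_or_gt_of_ne hij with hlt | hgt
  · -- `i < j`: `|xσb + yb| = |δ|·|ϖ|^{j−i} < 1`, but `xσb + yb = x + (y − x)b` is a unit
    obtain ⟨n, hn⟩ := Nat.exists_eq_add_of_lt hlt
    have hvi : Valued.v (ϖ ^ i) ≠ 0 := (Valuation.ne_zero_iff _).2 hϖi0
    have h1 : Valued.v δ * Valued.v (ϖ ^ (n + 1)) = Valued.v (x * σ b + y * b) := by
      have := congrArg Valued.v hE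
      rw [hn, show i + n + 1 = i + (n + 1) by ring, pow_add, map_mul, map_mul, map_mul, map_mul, hvΔκ, mul_one] at this
      apply mul_left_cancel₀ hvi
      rw [mul_left_comm]
      exact this
    have hlt1 : Valued.v (x * σ b + y * b) < 1 :=
      calc Valued.v (x * σ b + y * b) = Valued.v δ * Valued.v (ϖ ^ (n + 1)) := h1.symm
        _ ≤ 1 * Valued.v (ϖ ^ (n + 1)) := mul_le_mul_left hvδ _
        _ < 1 := by rw [one_mul]; exact v_pow_lt_one hvϖ (by omega)
    have hid : x * σ b + y * b = x + (y - x) * b := by linear_combination x * hb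
    have hsmall : Valued.v ((y - x) * b) < Valued.v x := by
      rw [map_mul, hvb, mul_one, hvx, ← neg_sub, Valuation.map_neg]; exact hxy
    have hunit : Valued.v (x * σ b + y * b) = 1 := by rw [hid, Valuation.map_add_eq_of_lt_left _ hsmall, hvx]
    rw [hunit] at hlt1
    exact lt_irrefl _ hlt1
  · -- `j < i`: `|xb + yσb| = |a|·|ϖ|^{i−j} < 1`, but `xb + yσb = y + (x − y)b` is a unit
    obtain ⟨n, hn⟩ := Nat.exists_eq_add_of_lt hgt
    have hvj : Valued.v (ϖ ^ j) ≠ 0 := (Valuation.ne_zero_iff _).2 hϖj0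
    have h1 : Valued.v a * Valued.v (ϖ ^ (n + 1)) = Valued.v (x * b + y * σ b) := by
      have := congrArg Valued.v hA
      rw [hn, show j + n + 1 = j + (n + 1) by ring, pow_add, map_mul, map_mul, map_mul, map_mul, hvΔκ, mul_one] at this
      apply mul_left_cancel₀ hvj
      rw [mul_left_comm]
      exact this
    have hlt1 : Valued.v (x * b + y * σ b) < 1 :=
      calc Valued.v (x * b + y * σ b) = Valued.v a * Valued.v (ϖ ^ (n + 1)) := h1.symm
        _ ≤ 1 * Valued.v (ϖ ^ (n + 1)) := mul_le_mul_left hva _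
        _ < 1 := by rw [one_mul]; exact v_pow_lt_one hvϖ (by omega)
    have hid : x * b + y * σ b = y + (x - y) * b := by linear_combination y * hb
    have hsmall : Valued.v ((x - y) * b) < Valued.v y := by
      rw [map_mul, hvb, mul_one, hvy]; exact hxy
    have hunit : Valued.v (x * b + y * σ b) = 1 := by rw [hid, Valuation.map_add_eq_of_lt_left _ hsmall, hvy]
    rw [hunit] at hlt1
    exact lt_irrefl _ hlt1

end Literature.NumberTheory.Automorphic.UnitaryGroup
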